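import Summits.QuantumFields.BalabanUV.Beta.FP.PeriodisedSymBorderT2IndexWardSnd
import Summits.QuantumFields.BalabanUV.Beta.FP.PeriodisedSymCompositeIndexWard

/-!
# `BalabanUV.Beta.FP.PeriodisedSymCompositeIndexWardTwo` — road «FP», row D1, ROUTE T, (J-a) (α) AT ORDER 2 ON THE AVERAGING SIDE: **THE SECOND-ORDER SIMILARITY
# WORD `q2` OF THE (III′) TORUS DOOR FOR THE COMPOSITE AVERAGING `𝔔 = Q₂·Q₁`** — the bi-analogue of `PeriodisedSymCompositeIndexWard.torus_q1_sym_letter`, with the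
# order-2 insertion tables BOUND as the OWNER d1-p3 g22 ruled (answer to Q-d1leaf02-g22-1, [D1P3-G22-ONLINE]): fine `Q₁₂ w w′ := −c_j • ΣΣ (w b·w′ b′) • Q₁₂^{b,b′}`
# (B1∕B2's bi-member; JA-TABLE v1.5 Δ1's weight), coarse `Q₂₂ w w′ := −c_{j+1} • ΣΣ (w̄ a′·w̄′ a″) • Q₂₂^{a′,a″} + Σ (θ_j·((Q₁₁ w)·w′) a′) • Q₂₁^{a′}` (`w̄ := θ_j•Q₁₀ w`).

WHAT (`d = 3`, fine level `j`, coarse level `j+1`, `F = fine Lc M′`, `c = c_j = (Lc⁴·stepScale 3 Lc j)⁻¹`, `c′ = c_{j+1}`, `θ = stepScale (j+1)∕(stepScale j²·#B)`;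
`h′ := h + Dλ`, `E = diagonal (λ b.1)`, `R = diagonal (λ̄ a.1)`, `R′ = diagonal (Σ_t tdelta M′ (pμ′ α + ρ_c) t·λ̄ t)`, `λ̄ t := Σ_s tdelta F (Lc•t + ρ_c) s·λ s`):
§1 `sum_sum_add_mul_mul_add_mul_smul`, `q2_sim_word` (pure algebra); §2 the four SHIFT letters — `torus_symQ11_shift` ((α-1)), `torus_symQ21_shift`
(`PeriodisedSymCompositeIndexWard.torus_symQ21_pureGauge_fun`), `torus_symQ12_shift` (B1∕B2 at `F`), `torus_symT22_shift` (B1∕B2 at `M′` + `torus_symQ10_mul_tgrad_fun`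
+ `theta_mul`); §3 **`torus_q2_sym_letter`**: `X̄X̄𝔔₀ + 2(X̄𝔔₁ + X̄𝔔₀X) + 𝔔₂ + 2𝔔₁X + 𝔔₀XX = Q₂₂♮ * Q₁₀ + 2 • (Q₂₁ h′ * Q₁₁ h′) + Q₂₀ * Q₁₂ h′ h′`,
`Q₂₂♮ := −c′ • Σ (w̄′ a′·w̄′ a″) • Q₂₂^{a′,a″} + Σ (θ·((Q₁₁ h)·h) a′) • Q₂₁^{a′}` — the bi-member summand SHIFTED to `w̄′ = θ•Q₁₀ h′`, the average map's second-jet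
summand UN-SHIFTED: the `Q`-side twin of an2's `torus_k2_sim_letter` (there the naive shift misses `w•(L·E_λ − E_λ·L)`, here it misses
`Σ_{a′} (θ·((Q₁₁ h′)·h′ − (Q₁₁ h)·h) a′) • Q₂₁^{a′}·Q₁₀` — a FLUCTUATION-LEG statement, DISPLAYED inside the name, not asserted; the OWNER's (TN) word).
[folklore] finite sums + matrix algebra BY NAME; no `def`, no `def … : Prop`, nothing cited, 0 sorry.  Nothing of the dictionary ∕ Bałaban's asserted.

HONEST DEPENDENCY (page 1, mandatory): continuum YM on T⁴ ⇐ BetaPertH ∧ nine spine estimates (0/9 proved); BetaPertH ⇐ (D1) ∧ (D4) ∧ CAP+tail;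
G-an2-4 gates asym, D1 and NE2/3/4.  HONEST FRAMING (cell contract, verbatim): «discharging `BetaPertH` makes Bałaban's UV stability UNCONDITIONAL —
a real constructive-QFT result; it is NOT the continuum limit and NOT the Clay problem.»  ABSOLUTE RULE (cell charter, verbatim): «No internally-minted
statement may enter as a cited fact. Every hypothesis is either kernel-proved in this package or a verbatim quotation of a PUBLISHED theorem with page
reference. The manuscript(s) under audit are NOT citable for their own disputed steps — they are the thing under adjudication; programme-internal
(2001/route/tribunal) claims are never citable.»  0 estimates; 0∕4 row-D1 binders; NOT (T-ID), NOT (J-a) complete, NOT SDF, NOT D1, NOT BetaPertH, NOT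
continuum, NOT Clay.  D1 formalisation swarm LEAF PROVER 02 (b2b-balaban-beta-d1-formalise-leaf-02 gen 22), 2026-08-22.  No existing file touched.
-/

noncomputable section
open scoped BigOperators
namespace Summit.QuantumFields.BalabanUV.Beta.FP.PeriodisedSymCompositeIndexWardTwo

open Finset Matrix
open Literature.MathematicalPhysics.QuantumFieldTheory.Balaban1983to89
open Literature.MathematicalPhysics.QuantumFieldTheory.Balaban1983to89.Beta
open B4TorusKernel.MultiPeriod (translate)
open ExpKernelCalculus (MKer)
open B5Prop11Plancherel (fine)
open B6Lemma24Torus (pbox mem_pbox)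
open AffineAveraging (Site box toSite)
open AveragingContoursRooted (ctr ctrOff ctrOff_mem_box)
open OneStepResolventKernel (Fib)
open Summit.QuantumFields.BalabanUV.Beta.BorderedHessian (stepScale stepScale_ne_zero)
open Summit.QuantumFields.BalabanUV.Beta.DshAn1 (Dsh)
open Summit.QuantumFields.BalabanUV.Beta.SymAveragingHessianCounts (symVhSAt)
open Summit.QuantumFields.BalabanUV.Beta.SymSecondOrderTablesAn1 (symVh₂SAn1)
open Summit.QuantumFields.BalabanUV.Beta.SymShiftedSpread (bhKStepSh)
open Summit.QuantumFields.BalabanUV.Beta.FP.KernelPeriodisationFib (Idx perF)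
open Summit.QuantumFields.BalabanUV.Beta.FP.KernelPeriodisationFibLoc (dper)
open Summit.QuantumFields.BalabanUV.Beta.FP.TorusGaugeCovariance (tdelta tgrad)
open Summit.QuantumFields.BalabanUV.Beta.FP.TorusGaugeCovarianceCoarse (coarsePt coarsePt_coe)
open Summit.QuantumFields.BalabanUV.Beta.FP.PeriodisedSymBorderIndexWard (torus_symQ11_pureGauge_fun)
open Summit.QuantumFields.BalabanUV.Beta.FP.PeriodisedCompositeIndexWard (theta_mul)
open Summit.QuantumFields.BalabanUV.Beta.FP.PeriodisedSymCompositeIndexWard (torus_symQ10_mul_tgrad_fun torus_symQ21_pureGauge_fun)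
open Summit.QuantumFields.BalabanUV.Beta.FP.PeriodisedSymBorderT2IndexWard (torus_symQ12_pureGauge_fst_fun_of_presentation)
open Summit.QuantumFields.BalabanUV.Beta.FP.PeriodisedSymBorderT2IndexWardSnd (torus_symQ12_gauge_fst_of_presentation torus_symQ12_gauge_snd_of_presentation
  torus_symQ12_gauge_fst torus_symQ12_gauge_snd)

/-! ## §1 Pure algebra -/

section Algebra

/-- [folklore] bilinear expansion of a bi-weighted sum along a shift by a scalar multiple: `Σ Σ ((h a + r·D a)(h b + r·D b)) • Φ a b`. -/
theorem sum_sum_add_mul_mul_add_mul_smul {ι V : Type*} [Fintype ι] [AddCommGroup V] [Module ℝ V] (h D : ι → ℝ) (r : ℝ) (Φ : ι → ι → V) :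
    ∑ a, ∑ b, ((h a + r * D a) * (h b + r * D b)) • Φ a b
      = ∑ a, ∑ b, (h a * h b) • Φ a b + r • ∑ a, ∑ b, (D a * h b) • Φ a b + r • ∑ a, ∑ b, (h a * D b) • Φ a b
        + (r * r) • ∑ a, ∑ b, (D a * D b) • Φ a b := by
  simp only [Finset.smul_sum, smul_smul, ← Finset.sum_add_distrib, ← add_smul]
  exact Finset.sum_congr rfl fun a _ => Finset.sum_congr rfl fun b _ => by ring_nf

/-- [folklore] **PURE ALGEBRA OF THE `q2` WORD** (rectangular matrices: `P₀ P₁ T V : κ × m`, `A B S : m × n`, `E : n × n`, `R : m × m`, `R′ : κ × κ`):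
with `X := −(c • E)`, `X̄ := c • R′`, the composite jets `𝔔₀ := P₀A`, `𝔔₁ := P₁A + P₀B`, `𝔔₂ := (T + V)A + P₁B + (P₁B + P₀S)` and the SHIFTED letters
`B′ = B + c•(RA − AE)`, `P₁′ = P₁ + c•(R′P₀ − P₀R)`, `S′ = S + c•((RB − BE) + (RB − BE) + c•(R(RA − AE) − (RA − AE)E))`,
`T′ = T + (c•(R′P₁ − P₁R) + c•(R′P₁ − P₁R)) + c•(R′(c•(R′P₀ − P₀R)) − (c•(R′P₀ − P₀R))R)`:
`X̄X̄𝔔₀ + (X̄𝔔₁ + X̄𝔔₀X) + ((X̄𝔔₁ + X̄𝔔₀X) + (𝔔₂ + 𝔔₁X + (𝔔₁X + 𝔔₀XX))) = (T′ + V)A + P₁′B′ + (P₁′B′ + P₀S′)` — the average map's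
second-jet summand `V` rides UN-SHIFTED. -/
theorem q2_sim_word {κ m n : Type*} [Fintype κ] [Fintype m] [Fintype n] [DecidableEq κ] [DecidableEq m] [DecidableEq n]
    (P₀ P₁ T V P₁' T' : Matrix κ m ℝ) (A B S B' S' : Matrix m n ℝ) (E : Matrix n n ℝ) (R : Matrix m m ℝ) (R' : Matrix κ κ ℝ) (c : ℝ)
    {X : Matrix n n ℝ} {Xbar : Matrix κ κ ℝ} (hX : X = -(c • E)) (hXbar : Xbar = c • R')
    (hB' : B' = B + c • (R * A - A * E)) (hP₁' : P₁' = P₁ + c • (R' * P₀ - P₀ * R))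
    (hS' : S' = S + c • ((R * B - B * E) + (R * B - B * E) + c • (R * (R * A - A * E) - (R * A - A * E) * E)))
    (hT' : T' = T + (c • (R' * P₁ - P₁ * R) + c • (R' * P₁ - P₁ * R)) + c • (R' * (c • (R' * P₀ - P₀ * R)) - (c • (R' * P₀ - P₀ * R)) * R)) :
    Xbar * Xbar * (P₀ * A) + (Xbar * (P₁ * A + P₀ * B) + Xbar * (P₀ * A) * X)
        + ((Xbar * (P₁ * A + P₀ * B) + Xbar * (P₀ * A) * X)
          + ((T + V) * A + P₁ * B + (P₁ * B + P₀ * S) + (P₁ * A + P₀ * B) * X + ((P₁ * A + P₀ * B) * X + P₀ * A * (X * X))))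
      = (T' + V) * A + P₁' * B' + (P₁' * B' + P₀ * S') := by
  subst hX hXbar hB' hP₁' hS' hT'
  simp only [Matrix.smul_mul, Matrix.mul_smul, smul_smul, smul_add, smul_sub, Matrix.mul_add, Matrix.add_mul, Matrix.mul_sub, Matrix.sub_mul,
    Matrix.mul_neg, Matrix.neg_mul, smul_neg, neg_neg, Matrix.mul_assoc]
  module

end Algebra

/-! ## §2 The four SHIFT letters at the (III′) torus door's types (`d = 3`, fine level `j`, coarse level `j+1`) -/

section Shifts

variable (M' : Fin 4 → ℕ) [∀ μ, NeZero (M' μ)] {Lc : ℕ} [NeZero Lc]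

/-- [folklore] **`torus_symQ11_shift` — THE FINE FIRST-ORDER INSERTION TABLE ALONG THE GAUGE-SHIFTED DIRECTION** ((α-1) `torus_symQ11_pureGauge_fun` + linearity):
`Q₁₁ (h + Dλ) = Q₁₁ h + c_j • (R·Q₁₀ − Q₁₀·E)`. -/
theorem torus_symQ11_shift (j : ℕ) (h : ↥(pbox (fine Lc M')) × Fin 4 → ℝ) (lam : ↥(pbox (fine Lc M')) → ℝ)
    {Q₁₀ : Matrix (↥(pbox M') × Fin 4) (↥(pbox (fine Lc M')) × Fin 4) ℝ}
    (hQ₁₀ : Q₁₀ = (perF (fine Lc M') (bhKStepSh 3 Lc (Dsh Lc) j)).submatrix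
        (fun a : ↥(pbox M') × Fin 4 => ((coarsePt M' Lc a.1, Sum.inr a.2) : Idx (fine Lc M') (Fib 3)))
        (fun b : ↥(pbox (fine Lc M')) × Fin 4 => ((b.1, Sum.inl b.2) : Idx (fine Lc M') (Fib 3))))
    (Q₁₁ : (↥(pbox (fine Lc M')) × Fin 4 → ℝ) → Matrix (↥(pbox M') × Fin 4) (↥(pbox (fine Lc M')) × Fin 4) ℝ)
    (hQ₁₁ : ∀ w, Q₁₁ w = ∑ b : ↥(pbox (fine Lc M')) × Fin 4, w b •
        (perF (fine Lc M') (dper (fine Lc M') (symVhSAt (ctr 4 Lc) 3 Lc rfl b.2 (b.1 : Site 4)))).submatrix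
          (fun a : ↥(pbox M') × Fin 4 => ((coarsePt M' Lc a.1, Sum.inr a.2) : Idx (fine Lc M') (Fib 3)))
          (fun b : ↥(pbox (fine Lc M')) × Fin 4 => ((b.1, Sum.inl b.2) : Idx (fine Lc M') (Fib 3)))) :
    Q₁₁ (fun b => h b + ∑ s : ↥(pbox (fine Lc M')), tgrad (fine Lc M') (b.1, Sum.inl b.2) s * lam s)
      = Q₁₁ h + (((Lc : ℝ) ^ (3 + 1) * stepScale 3 Lc j)⁻¹) • (Matrix.diagonal (fun a : ↥(pbox M') × Fin 4 => ∑ s : ↥(pbox (fine Lc M')), tdelta (fine Lc M') ((Lc : ℤ) • (a.1 : Site 4) + ctr 4 Lc) s * lam s) * Q₁₀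
          - Q₁₀ * Matrix.diagonal (fun b : ↥(pbox (fine Lc M')) × Fin 4 => lam b.1)) := by
  rw [hQ₁₁, hQ₁₁, ← torus_symQ11_pureGauge_fun M' j lam hQ₁₀, ← Finset.sum_add_distrib]
  exact Finset.sum_congr rfl fun b _ => add_smul _ _ _

omit [∀ μ, NeZero (M' μ)] [NeZero Lc] in
/-- [folklore] the chain-rule coarse insertion table read through the TRANSPORTED direction `w̄ a′ := θ_j·Σ_b Q₁₀ a′ b·w b`:
`Q₂₁ w = Σ_{a′} (w̄ a′) • Q₂₁^{a′}` (swap of the two finite sums in U18's `hQ₂₁`). -/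
theorem torus_symQ21_eq_sum_transported (j : ℕ) {κ : Type*} [Fintype κ] [DecidableEq κ] (pμ' : κ → ↥(pbox M')) (mμ' : κ → Fin 4)
    (Q₁₀ : Matrix (↥(pbox M') × Fin 4) (↥(pbox (fine Lc M')) × Fin 4) ℝ)
    (Q₂₁ : (↥(pbox (fine Lc M')) × Fin 4 → ℝ) → Matrix κ (↥(pbox M') × Fin 4) ℝ)
    (hQ₂₁ : ∀ w, Q₂₁ w = ∑ b : ↥(pbox (fine Lc M')) × Fin 4, w b •
        ∑ a' : ↥(pbox M') × Fin 4, ((stepScale 3 Lc (j + 1) / (stepScale 3 Lc j ^ 2 * ((box (3 + 1) Lc).card : ℝ))) * Q₁₀ a' b) •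
          (perF M' (dper M' (symVhSAt (ctr 4 Lc) 3 Lc rfl a'.2 (a'.1 : Site 4)))).submatrix (fun a : κ => ((pμ' a, Sum.inr (mμ' a)) : Idx M' (Fib 3)))
            (fun b : ↥(pbox M') × Fin 4 => ((b.1, Sum.inl b.2) : Idx M' (Fib 3))))
    (w : ↥(pbox (fine Lc M')) × Fin 4 → ℝ) :
    Q₂₁ w = ∑ a' : ↥(pbox M') × Fin 4, ((stepScale 3 Lc (j + 1) / (stepScale 3 Lc j ^ 2 * ((box (3 + 1) Lc).card : ℝ))) * ∑ b : ↥(pbox (fine Lc M')) × Fin 4, Q₁₀ a' b * w b) •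
          (perF M' (dper M' (symVhSAt (ctr 4 Lc) 3 Lc rfl a'.2 (a'.1 : Site 4)))).submatrix (fun a : κ => ((pμ' a, Sum.inr (mμ' a)) : Idx M' (Fib 3)))
            (fun b : ↥(pbox M') × Fin 4 => ((b.1, Sum.inl b.2) : Idx M' (Fib 3))) := by
  rw [hQ₂₁]
  simp only [Finset.smul_sum, smul_smul]
  rw [Finset.sum_comm]
  refine Finset.sum_congr rfl fun a' _ => ?_
  rw [← Finset.sum_smul, Finset.mul_sum]
  exact congrArg (· • _) (Finset.sum_congr rfl fun b _ => by ring)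

/-- [folklore] **`torus_symQ21_shift` — THE CHAIN-RULE COARSE INSERTION TABLE ALONG THE GAUGE-SHIFTED DIRECTION** (`PeriodisedSymCompositeIndexWard.torus_symQ21_pureGauge_fun`
+ linearity; `Lc ∣ M′ᵢ`): `Q₂₁ (h + Dλ) = Q₂₁ h + c_j • (R′·Q₂₀ − Q₂₀·R)`. -/
theorem torus_symQ21_shift (hM' : ∀ i, Lc ∣ M' i) (j : ℕ) (h : ↥(pbox (fine Lc M')) × Fin 4 → ℝ) (lam : ↥(pbox (fine Lc M')) → ℝ)
    {κ : Type*} [Fintype κ] [DecidableEq κ] (pμ' : κ → ↥(pbox M')) (mμ' : κ → Fin 4)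
    {Q₁₀ : Matrix (↥(pbox M') × Fin 4) (↥(pbox (fine Lc M')) × Fin 4) ℝ}
    (hQ₁₀ : Q₁₀ = (perF (fine Lc M') (bhKStepSh 3 Lc (Dsh Lc) j)).submatrix
        (fun a : ↥(pbox M') × Fin 4 => ((coarsePt M' Lc a.1, Sum.inr a.2) : Idx (fine Lc M') (Fib 3)))
        (fun b : ↥(pbox (fine Lc M')) × Fin 4 => ((b.1, Sum.inl b.2) : Idx (fine Lc M') (Fib 3))))
    {Q₂₀ : Matrix κ (↥(pbox M') × Fin 4) ℝ}
    (hQ₂₀ : Q₂₀ = (perF M' (bhKStepSh 3 Lc (Dsh Lc) (j + 1))).submatrix (fun a : κ => ((pμ' a, Sum.inr (mμ' a)) : Idx M' (Fib 3)))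
        (fun b : ↥(pbox M') × Fin 4 => ((b.1, Sum.inl b.2) : Idx M' (Fib 3))))
    (Q₂₁ : (↥(pbox (fine Lc M')) × Fin 4 → ℝ) → Matrix κ (↥(pbox M') × Fin 4) ℝ)
    (hQ₂₁ : ∀ w, Q₂₁ w = ∑ b : ↥(pbox (fine Lc M')) × Fin 4, w b •
        ∑ a' : ↥(pbox M') × Fin 4, ((stepScale 3 Lc (j + 1) / (stepScale 3 Lc j ^ 2 * ((box (3 + 1) Lc).card : ℝ))) * Q₁₀ a' b) •
          (perF M' (dper M' (symVhSAt (ctr 4 Lc) 3 Lc rfl a'.2 (a'.1 : Site 4)))).submatrix (fun a : κ => ((pμ' a, Sum.inr (mμ' a)) : Idx M' (Fib 3)))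
            (fun b : ↥(pbox M') × Fin 4 => ((b.1, Sum.inl b.2) : Idx M' (Fib 3)))) :
    Q₂₁ (fun b => h b + ∑ s : ↥(pbox (fine Lc M')), tgrad (fine Lc M') (b.1, Sum.inl b.2) s * lam s)
      = Q₂₁ h + (((Lc : ℝ) ^ (3 + 1) * stepScale 3 Lc j)⁻¹) •
          (Matrix.diagonal (fun α : κ => ∑ t : ↥(pbox M'), tdelta M' ((pμ' α : Site 4) + ctr 4 Lc) t
              * (∑ s : ↥(pbox (fine Lc M')), tdelta (fine Lc M') ((Lc : ℤ) • (t : Site 4) + ctr 4 Lc) s * lam s)) * Q₂₀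
            - Q₂₀ * Matrix.diagonal (fun a : ↥(pbox M') × Fin 4 => ∑ s : ↥(pbox (fine Lc M')), tdelta (fine Lc M') ((Lc : ℤ) • (a.1 : Site 4) + ctr 4 Lc) s * lam s)) := by
  rw [torus_symQ21_eq_sum_transported M' j pμ' mμ' Q₁₀ Q₂₁ hQ₂₁, torus_symQ21_eq_sum_transported M' j pμ' mμ' Q₁₀ Q₂₁ hQ₂₁ h,
    ← torus_symQ21_pureGauge_fun M' hM' j lam pμ' mμ' hQ₁₀ hQ₂₀, ← Finset.sum_add_distrib]
  refine Finset.sum_congr rfl fun a' _ => ?_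
  rw [← add_smul]
  congr 1
  rw [← mul_add, ← Finset.sum_add_distrib]
  refine congrArg (_ * ·) (Finset.sum_congr rfl fun b _ => by ring)

/-- [folklore] **`torus_symQ12_shift` — THE FINE SECOND-ORDER INSERTION TABLE ALONG THE GAUGE-SHIFTED PAIR `(h + Dλ) ⊗ (h + Dλ)`** (B1∕B2 at `F = fine Lc M′`: the two
cross laws + the first-slot law along the pure gauge itself, read through (α-1)): with `Q₁₂ w w′ := −c_j • Σ_b Σ_{b′} (w b·w′ b′) • Q₁₂^{b,b′}`,
`Q₁₂ h′ h′ = Q₁₂ h h + c_j • ((R·Q₁₁ h − Q₁₁ h·E) + (R·Q₁₁ h − Q₁₁ h·E) + c_j • (R·(R·Q₁₀ − Q₁₀·E) − (R·Q₁₀ − Q₁₀·E)·E))`. -/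
theorem torus_symQ12_shift (j : ℕ) (h : ↥(pbox (fine Lc M')) × Fin 4 → ℝ) (lam : ↥(pbox (fine Lc M')) → ℝ)
    {Q₁₀ : Matrix (↥(pbox M') × Fin 4) (↥(pbox (fine Lc M')) × Fin 4) ℝ}
    (hQ₁₀ : Q₁₀ = (perF (fine Lc M') (bhKStepSh 3 Lc (Dsh Lc) j)).submatrix
        (fun a : ↥(pbox M') × Fin 4 => ((coarsePt M' Lc a.1, Sum.inr a.2) : Idx (fine Lc M') (Fib 3)))
        (fun b : ↥(pbox (fine Lc M')) × Fin 4 => ((b.1, Sum.inl b.2) : Idx (fine Lc M') (Fib 3))))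
    (Q₁₁ : (↥(pbox (fine Lc M')) × Fin 4 → ℝ) → Matrix (↥(pbox M') × Fin 4) (↥(pbox (fine Lc M')) × Fin 4) ℝ)
    (hQ₁₁ : ∀ w, Q₁₁ w = ∑ b : ↥(pbox (fine Lc M')) × Fin 4, w b •
        (perF (fine Lc M') (dper (fine Lc M') (symVhSAt (ctr 4 Lc) 3 Lc rfl b.2 (b.1 : Site 4)))).submatrix
          (fun a : ↥(pbox M') × Fin 4 => ((coarsePt M' Lc a.1, Sum.inr a.2) : Idx (fine Lc M') (Fib 3)))
          (fun b : ↥(pbox (fine Lc M')) × Fin 4 => ((b.1, Sum.inl b.2) : Idx (fine Lc M') (Fib 3))))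
    {W₁₂ : Fin 4 → Site 4 → Fin 4 → Site 4 → MKer 4 (Fib 3)}
    (hW₁₂ : W₁₂ = fun κ' u' κ u x z a c => ∑' n : Site 4, symVh₂SAn1 3 Lc κ u κ' (translate (fine Lc M') u' n) x z a c)
    (Q₁₂ : (↥(pbox (fine Lc M')) × Fin 4 → ℝ) → (↥(pbox (fine Lc M')) × Fin 4 → ℝ) → Matrix (↥(pbox M') × Fin 4) (↥(pbox (fine Lc M')) × Fin 4) ℝ)
    (hQ₁₂ : ∀ w w', Q₁₂ w w' = -(((Lc : ℝ) ^ (3 + 1) * stepScale 3 Lc j)⁻¹) • ∑ b : ↥(pbox (fine Lc M')) × Fin 4, ∑ b' : ↥(pbox (fine Lc M')) × Fin 4, (w b * w' b') •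
        (perF (fine Lc M') (dper (fine Lc M') (W₁₂ b'.2 (b'.1 : Site 4) b.2 (b.1 : Site 4)))).submatrix
          (fun a : ↥(pbox M') × Fin 4 => ((coarsePt M' Lc a.1, Sum.inr a.2) : Idx (fine Lc M') (Fib 3)))
          (fun c : ↥(pbox (fine Lc M')) × Fin 4 => ((c.1, Sum.inl c.2) : Idx (fine Lc M') (Fib 3)))) :
    Q₁₂ (fun b => h b + ∑ s : ↥(pbox (fine Lc M')), tgrad (fine Lc M') (b.1, Sum.inl b.2) s * lam s) (fun b => h b + ∑ s : ↥(pbox (fine Lc M')), tgrad (fine Lc M') (b.1, Sum.inl b.2) s * lam s)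
      = Q₁₂ h h + (((Lc : ℝ) ^ (3 + 1) * stepScale 3 Lc j)⁻¹) •
          ((Matrix.diagonal (fun a : ↥(pbox M') × Fin 4 => ∑ s : ↥(pbox (fine Lc M')), tdelta (fine Lc M') ((Lc : ℤ) • (a.1 : Site 4) + ctr 4 Lc) s * lam s) * Q₁₁ h
              - Q₁₁ h * Matrix.diagonal (fun b : ↥(pbox (fine Lc M')) × Fin 4 => lam b.1))
            + (Matrix.diagonal (fun a : ↥(pbox M') × Fin 4 => ∑ s : ↥(pbox (fine Lc M')), tdelta (fine Lc M') ((Lc : ℤ) • (a.1 : Site 4) + ctr 4 Lc) s * lam s) * Q₁₁ h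
              - Q₁₁ h * Matrix.diagonal (fun b : ↥(pbox (fine Lc M')) × Fin 4 => lam b.1))
            + (((Lc : ℝ) ^ (3 + 1) * stepScale 3 Lc j)⁻¹) •
              (Matrix.diagonal (fun a : ↥(pbox M') × Fin 4 => ∑ s : ↥(pbox (fine Lc M')), tdelta (fine Lc M') ((Lc : ℤ) • (a.1 : Site 4) + ctr 4 Lc) s * lam s)
                  * (Matrix.diagonal (fun a : ↥(pbox M') × Fin 4 => ∑ s : ↥(pbox (fine Lc M')), tdelta (fine Lc M') ((Lc : ℤ) • (a.1 : Site 4) + ctr 4 Lc) s * lam s) * Q₁₀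
                    - Q₁₀ * Matrix.diagonal (fun b : ↥(pbox (fine Lc M')) × Fin 4 => lam b.1))
                - (Matrix.diagonal (fun a : ↥(pbox M') × Fin 4 => ∑ s : ↥(pbox (fine Lc M')), tdelta (fine Lc M') ((Lc : ℤ) • (a.1 : Site 4) + ctr 4 Lc) s * lam s) * Q₁₀
                    - Q₁₀ * Matrix.diagonal (fun b : ↥(pbox (fine Lc M')) × Fin 4 => lam b.1))
                  * Matrix.diagonal (fun b : ↥(pbox (fine Lc M')) × Fin 4 => lam b.1))) := by
  have h1 := torus_symQ11_pureGauge_fun M' j lam hQ₁₀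
  have hf := torus_symQ12_gauge_fst M' hW₁₂ h lam
  have hs := torus_symQ12_gauge_snd M' hW₁₂ h lam
  have hd := torus_symQ12_gauge_fst M' hW₁₂
    (fun b : ↥(pbox (fine Lc M')) × Fin 4 => ∑ s : ↥(pbox (fine Lc M')), tgrad (fine Lc M') (b.1, Sum.inl b.2) s * lam s) lam
  simp only [Nat.reduceAdd] at h1 hf hs hd ⊢
  rw [hQ₁₂, hQ₁₂, CombWilsonT2PeriodisedK2.sum_sum_add_mul_add_smul, hf, hs, hd, h1, ← hQ₁₁ h]
  simp only [Nat.reduceAdd, smul_add, smul_sub, smul_neg, neg_smul, Matrix.mul_sub, Matrix.sub_mul, Matrix.mul_smul, Matrix.smul_mul, smul_smul,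
    Matrix.mul_assoc]
  module

/-- [folklore] **`torus_symT22_shift` — THE COARSE BI-MEMBER SUMMAND OF `Q₂₂` ALONG THE GAUGE-SHIFTED PAIR** (B1∕B2 on the coarse box `M′` at the presentation
`pμ′` with the INDUCED gauge function `λ̄ t := Σ_s tdelta F (Lc•t + ρ_c) s·λ s`; the transported direction shifts by `w̄′ = w̄ + θ·stepScale_j·#B • Dλ̄`
(`torus_symQ10_mul_tgrad_fun`); `θ·stepScale_j·#B·c_{j+1} = c_j` (`theta_mul`); `Lc ∣ M′ᵢ`):
`−c_{j+1} • Σ_{a′,a″} (w̄′ a′·w̄′ a″) • Q₂₂^{a′,a″} = −c_{j+1} • Σ_{a′,a″} (w̄ a′·w̄ a″) • Q₂₂^{a′,a″} + (c_j•(R′·Q₂₁ h − Q₂₁ h·R) + c_j•(R′·Q₂₁ h − Q₂₁ h·R))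
+ c_j • (R′·(c_j•(R′·Q₂₀ − Q₂₀·R)) − (c_j•(R′·Q₂₀ − Q₂₀·R))·R)`. -/
theorem torus_symT22_shift (hM' : ∀ i, Lc ∣ M' i) (j : ℕ) (h : ↥(pbox (fine Lc M')) × Fin 4 → ℝ) (lam : ↥(pbox (fine Lc M')) → ℝ)
    {κ : Type*} [Fintype κ] [DecidableEq κ] (pμ' : κ → ↥(pbox M')) (mμ' : κ → Fin 4)
    {Q₁₀ : Matrix (↥(pbox M') × Fin 4) (↥(pbox (fine Lc M')) × Fin 4) ℝ}
    (hQ₁₀ : Q₁₀ = (perF (fine Lc M') (bhKStepSh 3 Lc (Dsh Lc) j)).submatrix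
        (fun a : ↥(pbox M') × Fin 4 => ((coarsePt M' Lc a.1, Sum.inr a.2) : Idx (fine Lc M') (Fib 3)))
        (fun b : ↥(pbox (fine Lc M')) × Fin 4 => ((b.1, Sum.inl b.2) : Idx (fine Lc M') (Fib 3))))
    {Q₂₀ : Matrix κ (↥(pbox M') × Fin 4) ℝ}
    (hQ₂₀ : Q₂₀ = (perF M' (bhKStepSh 3 Lc (Dsh Lc) (j + 1))).submatrix (fun a : κ => ((pμ' a, Sum.inr (mμ' a)) : Idx M' (Fib 3)))
        (fun b : ↥(pbox M') × Fin 4 => ((b.1, Sum.inl b.2) : Idx M' (Fib 3))))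
    (Q₂₁ : (↥(pbox (fine Lc M')) × Fin 4 → ℝ) → Matrix κ (↥(pbox M') × Fin 4) ℝ)
    (hQ₂₁ : ∀ w, Q₂₁ w = ∑ b : ↥(pbox (fine Lc M')) × Fin 4, w b •
        ∑ a' : ↥(pbox M') × Fin 4, ((stepScale 3 Lc (j + 1) / (stepScale 3 Lc j ^ 2 * ((box (3 + 1) Lc).card : ℝ))) * Q₁₀ a' b) •
          (perF M' (dper M' (symVhSAt (ctr 4 Lc) 3 Lc rfl a'.2 (a'.1 : Site 4)))).submatrix (fun a : κ => ((pμ' a, Sum.inr (mμ' a)) : Idx M' (Fib 3)))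
            (fun b : ↥(pbox M') × Fin 4 => ((b.1, Sum.inl b.2) : Idx M' (Fib 3))))
    {W₂₂ : Fin 4 → Site 4 → Fin 4 → Site 4 → MKer 4 (Fib 3)}
    (hW₂₂ : W₂₂ = fun κ' u' κ u x z a c => ∑' n : Site 4, symVh₂SAn1 3 Lc κ u κ' (translate M' u' n) x z a c) :
    -(((Lc : ℝ) ^ (3 + 1) * stepScale 3 Lc (j + 1))⁻¹) • (∑ a' : ↥(pbox M') × Fin 4, ∑ a'' : ↥(pbox M') × Fin 4,
        (((stepScale 3 Lc (j + 1) / (stepScale 3 Lc j ^ 2 * ((box (3 + 1) Lc).card : ℝ))) * ∑ b : ↥(pbox (fine Lc M')) × Fin 4, Q₁₀ a' b * (h b + ∑ s : ↥(pbox (fine Lc M')), tgrad (fine Lc M') (b.1, Sum.inl b.2) s * lam s)) * ((stepScale 3 Lc (j + 1) / (stepScale 3 Lc j ^ 2 * ((box (3 + 1) Lc).card : ℝ))) * ∑ b : ↥(pbox (fine Lc M')) × Fin 4, Q₁₀ a'' b * (h b + ∑ s : ↥(pbox (fine Lc M')), tgrad (fine Lc M') (b.1, Sum.inl b.2) s *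 lam s))) •
          (perF M' (dper M' (W₂₂ a''.2 (a''.1 : Site 4) a'.2 (a'.1 : Site 4)))).submatrix (fun a : κ => ((pμ' a, Sum.inr (mμ' a)) : Idx M' (Fib 3)))
            (fun b : ↥(pbox M') × Fin 4 => ((b.1, Sum.inl b.2) : Idx M' (Fib 3))))
      = -(((Lc : ℝ) ^ (3 + 1) * stepScale 3 Lc (j + 1))⁻¹) • (∑ a' : ↥(pbox M') × Fin 4, ∑ a'' : ↥(pbox M') × Fin 4,
          (((stepScale 3 Lc (j + 1) / (stepScale 3 Lc j ^ 2 * ((box (3 + 1) Lc).card : ℝ))) * ∑ b : ↥(pbox (fine Lc M')) × Fin 4, Q₁₀ a' b * h b) * ((stepScale 3 Lc (j + 1) / (stepScale 3 Lc j ^ 2 * ((box (3 + 1) Lc).card : ℝ))) * ∑ b : ↥(pbox (fine Lc M')) × Fin 4, Q₁₀ a'' b * h b)) •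
            (perF M' (dper M' (W₂₂ a''.2 (a''.1 : Site 4) a'.2 (a'.1 : Site 4)))).submatrix (fun a : κ => ((pμ' a, Sum.inr (mμ' a)) : Idx M' (Fib 3)))
            (fun b : ↥(pbox M') × Fin 4 => ((b.1, Sum.inl b.2) : Idx M' (Fib 3))))
        + ((((Lc : ℝ) ^ (3 + 1) * stepScale 3 Lc j)⁻¹) • (Matrix.diagonal (fun α : κ => ∑ t : ↥(pbox M'), tdelta M' ((pμ' α : Site 4) + ctr 4 Lc) t
              * (∑ s : ↥(pbox (fine Lc M')), tdelta (fine Lc M') ((Lc : ℤ) • (t : Site 4) + ctr 4 Lc) s * lam s)) * Q₂₁ h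
              - Q₂₁ h * Matrix.diagonal (fun a : ↥(pbox M') × Fin 4 => ∑ s : ↥(pbox (fine Lc M')), tdelta (fine Lc M') ((Lc : ℤ) • (a.1 : Site 4) + ctr 4 Lc) s * lam s))
          + (((Lc : ℝ) ^ (3 + 1) * stepScale 3 Lc j)⁻¹) • (Matrix.diagonal (fun α : κ => ∑ t : ↥(pbox M'), tdelta M' ((pμ' α : Site 4) + ctr 4 Lc) t
              * (∑ s : ↥(pbox (fine Lc M')), tdelta (fine Lc M') ((Lc : ℤ) • (t : Site 4) + ctr 4 Lc) s * lam s)) * Q₂₁ h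
              - Q₂₁ h * Matrix.diagonal (fun a : ↥(pbox M') × Fin 4 => ∑ s : ↥(pbox (fine Lc M')), tdelta (fine Lc M') ((Lc : ℤ) • (a.1 : Site 4) + ctr 4 Lc) s * lam s)))
        + (((Lc : ℝ) ^ (3 + 1) * stepScale 3 Lc j)⁻¹) • (Matrix.diagonal (fun α : κ => ∑ t : ↥(pbox M'), tdelta M' ((pμ' α : Site 4) + ctr 4 Lc) t
              * (∑ s : ↥(pbox (fine Lc M')), tdelta (fine Lc M') ((Lc : ℤ) • (t : Site 4) + ctr 4 Lc) s * lam s))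
              * ((((Lc : ℝ) ^ (3 + 1) * stepScale 3 Lc j)⁻¹) • (Matrix.diagonal (fun α : κ => ∑ t : ↥(pbox M'), tdelta M' ((pμ' α : Site 4) + ctr 4 Lc) t
              * (∑ s : ↥(pbox (fine Lc M')), tdelta (fine Lc M') ((Lc : ℤ) • (t : Site 4) + ctr 4 Lc) s * lam s)) * Q₂₀
                  - Q₂₀ * Matrix.diagonal (fun a : ↥(pbox M') × Fin 4 => ∑ s : ↥(pbox (fine Lc M')), tdelta (fine Lc M') ((Lc : ℤ) • (a.1 : Site 4) + ctr 4 Lc) s * lam s)))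
            - ((((Lc : ℝ) ^ (3 + 1) * stepScale 3 Lc j)⁻¹) • (Matrix.diagonal (fun α : κ => ∑ t : ↥(pbox M'), tdelta M' ((pμ' α : Site 4) + ctr 4 Lc) t
              * (∑ s : ↥(pbox (fine Lc M')), tdelta (fine Lc M') ((Lc : ℤ) • (t : Site 4) + ctr 4 Lc) s * lam s)) * Q₂₀
                  - Q₂₀ * Matrix.diagonal (fun a : ↥(pbox M') × Fin 4 => ∑ s : ↥(pbox (fine Lc M')), tdelta (fine Lc M') ((Lc : ℤ) • (a.1 : Site 4) + ctr 4 Lc) s * lam s)))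
              * Matrix.diagonal (fun a : ↥(pbox M') × Fin 4 => ∑ s : ↥(pbox (fine Lc M')), tdelta (fine Lc M') ((Lc : ℤ) • (a.1 : Site 4) + ctr 4 Lc) s * lam s)) := by
  have hM'' : ∀ i, M' i = Lc * (M' i / Lc) := fun i => (Nat.mul_div_cancel' (hM' i)).symm
  -- the letters of record, numerals normalised (`3 + 1 ↦ 4`), beta-reduced
  have hL5 := fun a' : ↥(pbox M') × Fin 4 => torus_symQ10_mul_tgrad_fun M' j lam hQ₁₀ a'
  have hL2 := torus_symQ21_pureGauge_fun M' hM' j lam pμ' mμ' hQ₁₀ hQ₂₀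
  have hθ := theta_mul (d := 3) (Lc := Lc) j
  have ht := torus_symQ21_eq_sum_transported M' j pμ' mμ' Q₁₀ Q₂₁ hQ₂₁ h
  have hf := torus_symQ12_gauge_fst_of_presentation hM'' hW₂₂ (fun a : κ => ((pμ' a : ↥(pbox M')) : Site 4)) (fun a => (pμ' a).2) mμ'
      (fun a' : ↥(pbox M') × Fin 4 => (stepScale 3 Lc (j + 1) / (stepScale 3 Lc j ^ 2 * ((box 4 Lc).card : ℝ))) * ∑ b : ↥(pbox (fine Lc M')) × Fin 4, Q₁₀ a' b * h b)
      (fun t : ↥(pbox M') => ∑ s : ↥(pbox (fine Lc M')), tdelta (fine Lc M') ((Lc : ℤ) • (t : Site 4) + ctr 4 Lc) s * lam s)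
  have hs := torus_symQ12_gauge_snd_of_presentation hM'' hW₂₂ (fun a : κ => ((pμ' a : ↥(pbox M')) : Site 4)) (fun a => (pμ' a).2) mμ'
      (fun a' : ↥(pbox M') × Fin 4 => (stepScale 3 Lc (j + 1) / (stepScale 3 Lc j ^ 2 * ((box 4 Lc).card : ℝ))) * ∑ b : ↥(pbox (fine Lc M')) × Fin 4, Q₁₀ a' b * h b)
      (fun t : ↥(pbox M') => ∑ s : ↥(pbox (fine Lc M')), tdelta (fine Lc M') ((Lc : ℤ) • (t : Site 4) + ctr 4 Lc) s * lam s)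
  have hd := torus_symQ12_gauge_fst_of_presentation hM'' hW₂₂ (fun a : κ => ((pμ' a : ↥(pbox M')) : Site 4)) (fun a => (pμ' a).2) mμ'
      (fun a' : ↥(pbox M') × Fin 4 => ∑ t : ↥(pbox M'), tgrad M' (a'.1, Sum.inl a'.2) t
              * (∑ s : ↥(pbox (fine Lc M')), tdelta (fine Lc M') ((Lc : ℤ) • (t : Site 4) + ctr 4 Lc) s * lam s))
      (fun t : ↥(pbox M') => ∑ s : ↥(pbox (fine Lc M')), tdelta (fine Lc M') ((Lc : ℤ) • (t : Site 4) + ctr 4 Lc) s * lam s)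
  simp only [Nat.reduceAdd] at hL5 hL2 hθ ht hf hs hd ⊢
  -- the transported direction shifts by `ϑ′ • Dλ̄`, `ϑ′ = θ·stepScale_j·#B`
  have hw : ∀ a' : ↥(pbox M') × Fin 4, (stepScale 3 Lc (j + 1) / (stepScale 3 Lc j ^ 2 * ((box 4 Lc).card : ℝ))) * ∑ b : ↥(pbox (fine Lc M')) × Fin 4, Q₁₀ a' b * (h b + ∑ s : ↥(pbox (fine Lc M')), tgrad (fine Lc M') (b.1, Sum.inl b.2) s * lam s)
      = (stepScale 3 Lc (j + 1) / (stepScale 3 Lc j ^ 2 * ((box 4 Lc).card : ℝ))) * ∑ b : ↥(pbox (fine Lc M')) × Fin 4, Q₁₀ a' b * h b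
        + ((stepScale 3 Lc (j + 1) / (stepScale 3 Lc j ^ 2 * ((box 4 Lc).card : ℝ))) * (stepScale 3 Lc j * ((box 4 Lc).card : ℝ)))
          * (∑ t : ↥(pbox M'), tgrad M' (a'.1, Sum.inl a'.2) t
              * (∑ s : ↥(pbox (fine Lc M')), tdelta (fine Lc M') ((Lc : ℤ) • (t : Site 4) + ctr 4 Lc) s * lam s)) := fun a' => by
    rw [mul_assoc, ← hL5 a', ← mul_add, ← Finset.sum_add_distrib]
    exact congrArg (_ * ·) (Finset.sum_congr rfl fun b _ => by ring)
  simp only [hw]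
  rw [sum_sum_add_mul_mul_add_mul_smul, hf, hs, hd, ← ht]
  -- the pure-gauge member `Σ_{a′} (Dλ̄)_{a′} • Q₂₁^{a′}`: `ϑ′ •` it is the (α-1b) `Q₂`-word `c_j • (R′·Q₂₀ − Q₂₀·R)`
  have hQ2 : ((stepScale 3 Lc (j + 1) / (stepScale 3 Lc j ^ 2 * ((box 4 Lc).card : ℝ))) * (stepScale 3 Lc j * ((box 4 Lc).card : ℝ)))
      • (∑ a' : ↥(pbox M') × Fin 4, (∑ t : ↥(pbox M'), tgrad M' (a'.1, Sum.inl a'.2) t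
              * (∑ s : ↥(pbox (fine Lc M')), tdelta (fine Lc M') ((Lc : ℤ) • (t : Site 4) + ctr 4 Lc) s * lam s)) •
          (perF M' (dper M' (symVhSAt (ctr 4 Lc) 3 Lc rfl a'.2 (a'.1 : Site 4)))).submatrix (fun a : κ => ((pμ' a, Sum.inr (mμ' a)) : Idx M' (Fib 3)))
            (fun b : ↥(pbox M') × Fin 4 => ((b.1, Sum.inl b.2) : Idx M' (Fib 3))))
      = (((Lc : ℝ) ^ 4 * stepScale 3 Lc j)⁻¹) • (Matrix.diagonal (fun α : κ => ∑ t : ↥(pbox M'), tdelta M' ((pμ' α : Site 4) + ctr 4 Lc) t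
              * (∑ s : ↥(pbox (fine Lc M')), tdelta (fine Lc M') ((Lc : ℤ) • (t : Site 4) + ctr 4 Lc) s * lam s)) * Q₂₀
          - Q₂₀ * Matrix.diagonal (fun a : ↥(pbox M') × Fin 4 => ∑ s : ↥(pbox (fine Lc M')), tdelta (fine Lc M') ((Lc : ℤ) • (a.1 : Site 4) + ctr 4 Lc) s * lam s)) := by
    rw [← hL2, Finset.smul_sum]
    refine Finset.sum_congr rfl fun a' _ => ?_
    rw [smul_smul, hL5 a']
    congr 1
    ring
  rw [show ∀ (ϑ : ℝ) (Y : Matrix κ (↥(pbox M') × Fin 4) ℝ), (ϑ * ϑ) • -(Matrix.diagonal (fun α : κ => ∑ t : ↥(pbox M'), tdelta M' ((pμ' α : Site 4) + ctr 4 Lc) t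
              * (∑ s : ↥(pbox (fine Lc M')), tdelta (fine Lc M') ((Lc : ℤ) • (t : Site 4) + ctr 4 Lc) s * lam s)) * Y - Y * Matrix.diagonal (fun a : ↥(pbox M') × Fin 4 => ∑ s : ↥(pbox (fine Lc M')), tdelta (fine Lc M') ((Lc : ℤ) • (a.1 : Site 4) + ctr 4 Lc) s * lam s))
      = -(Matrix.diagonal (fun α : κ => ∑ t : ↥(pbox M'), tdelta M' ((pμ' α : Site 4) + ctr 4 Lc) t
              * (∑ s : ↥(pbox (fine Lc M')), tdelta (fine Lc M') ((Lc : ℤ) • (t : Site 4) + ctr 4 Lc) s * lam s)) * (ϑ • (ϑ • Y)) - (ϑ • (ϑ • Y)) * Matrix.diagonal (fun a : ↥(pbox M') × Fin 4 => ∑ s : ↥(pbox (fine Lc M')), tdelta (fine Lc M') ((Lc : ℤ) • (a.1 : Site 4) + ctr 4 Lc) s * lam s)) from fun ϑ Y => by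
        rw [Matrix.mul_smul, Matrix.mul_smul, Matrix.smul_mul, Matrix.smul_mul, ← smul_sub, ← smul_sub, smul_smul, smul_neg],
    hQ2]
  -- `c_j = ϑ′·c_{j+1}`: make every scalar a polynomial in `ϑ′, c_{j+1}`
  rw [← hθ]
  simp only [Nat.reduceAdd, smul_add, smul_sub, smul_neg, neg_smul, Matrix.mul_sub, Matrix.sub_mul, Matrix.mul_smul, Matrix.smul_mul, smul_smul,
    Matrix.mul_assoc]
  module

end Shifts

/-! ## §3 The `q2` letter -/

section Letter

variable (M' : Fin 4 → ℕ) [∀ μ, NeZero (M' μ)] {Lc : ℕ} [NeZero Lc]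

/-- [folklore] **`torus_q2_sym_letter` — `q2` AT THE (III′) TABLES, IN THE LETTER SHAPE OF THE GRADED TORUS DOOR** (U18∕U20 at `d = 3`: `q2 :
X̄X̄𝔔₀ + (X̄𝔔₁ + X̄𝔔₀X) + ((X̄𝔔₁ + X̄𝔔₀X) + (𝔔₂ + 𝔔₁X + (𝔔₁X + 𝔔₀XX))) = 𝔔′₂`, the composite jets NAMED by `h𝔔₀ h𝔔₁ h𝔔₂`, the transports
`hX hXbar` VERBATIM, fine level `j`, coarse level `j+1`): with the order-2 insertion tables BOUND as the OWNER d1-p3 g22 ruled — `Q₁₂ w w′ := −c_j • Σ_b Σ_{b′}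
(w b·w′ b′) • Q₁₂^{b,b′}` (B1∕B2's border bi-member on `F = fine Lc M′`), `Q₂₂ w w′ := −c_{j+1} • Σ_{a′,a″} (w̄ a′·w̄′ a″) • Q₂₂^{a′,a″} + Σ_{a′} (θ_j·((Q₁₁ w)·w′) a′) •
Q₂₁^{a′}` (the bi-member on `M′` along the TRANSPORTED directions `w̄ = θ_j•Q₁₀ w`, plus the average map's second jet against the coarse first-order member) — the
`q2` word EQUALS `Q₂₂♮ * Q₁₀ + Q₂₁ h′ * Q₁₁ h′ + (Q₂₁ h′ * Q₁₁ h′ + Q₂₀ * Q₁₂ h′ h′)`, `h′ := h + Dλ`, where `Q₂₂♮ := −c_{j+1} • Σ_{a′,a″} (w̄′ a′·w̄′ a″) • Q₂₂^{a′,a″}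
+ Σ_{a′} (θ_j·((Q₁₁ h)·h) a′) • Q₂₁^{a′}` — the bi-member summand along the SHIFTED transported direction `w̄′ = θ_j•Q₁₀ h′`, the average map's second-jet summand
UN-SHIFTED (the `Q`-side twin of `torus_k2_sim_letter`'s displayed `w•(L·E_λ − E_λ·L)`: the naive shift would need `Σ_{a′} (θ_j·((Q₁₁ h′)·h′ − (Q₁₁ h)·h) a′) • Q₂₁^{a′}`
to vanish — a FLUCTUATION-LEG statement, displayed inside the name, not asserted).  Proof = the four shift letters fed to `q2_sim_word`. -/
theorem torus_q2_sym_letter (hM' : ∀ i, Lc ∣ M' i) (j : ℕ)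
    (h : ↥(pbox (fine Lc M')) × Fin 4 → ℝ) (lam : ↥(pbox (fine Lc M')) → ℝ)
    {κ : Type*} [Fintype κ] [DecidableEq κ] (pμ' : κ → ↥(pbox M')) (mμ' : κ → Fin 4)
    {Q₁₀ : Matrix (↥(pbox M') × Fin 4) (↥(pbox (fine Lc M')) × Fin 4) ℝ}
    (hQ₁₀ : Q₁₀ = (perF (fine Lc M') (bhKStepSh 3 Lc (Dsh Lc) j)).submatrix
        (fun a : ↥(pbox M') × Fin 4 => ((coarsePt M' Lc a.1, Sum.inr a.2) : Idx (fine Lc M') (Fib 3)))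
        (fun b : ↥(pbox (fine Lc M')) × Fin 4 => ((b.1, Sum.inl b.2) : Idx (fine Lc M') (Fib 3))))
    {Q₂₀ : Matrix κ (↥(pbox M') × Fin 4) ℝ}
    (hQ₂₀ : Q₂₀ = (perF M' (bhKStepSh 3 Lc (Dsh Lc) (j + 1))).submatrix (fun a : κ => ((pμ' a, Sum.inr (mμ' a)) : Idx M' (Fib 3)))
        (fun b : ↥(pbox M') × Fin 4 => ((b.1, Sum.inl b.2) : Idx M' (Fib 3))))
    (Q₁₁ : (↥(pbox (fine Lc M')) × Fin 4 → ℝ) → Matrix (↥(pbox M') × Fin 4) (↥(pbox (fine Lc M')) × Fin 4) ℝ)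
    (hQ₁₁ : ∀ w, Q₁₁ w = ∑ b : ↥(pbox (fine Lc M')) × Fin 4, w b •
        (perF (fine Lc M') (dper (fine Lc M') (symVhSAt (ctr 4 Lc) 3 Lc rfl b.2 (b.1 : Site 4)))).submatrix
          (fun a : ↥(pbox M') × Fin 4 => ((coarsePt M' Lc a.1, Sum.inr a.2) : Idx (fine Lc M') (Fib 3)))
          (fun b : ↥(pbox (fine Lc M')) × Fin 4 => ((b.1, Sum.inl b.2) : Idx (fine Lc M') (Fib 3))))
    (Q₂₁ : (↥(pbox (fine Lc M')) × Fin 4 → ℝ) → Matrix κ (↥(pbox M') × Fin 4) ℝ)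
    (hQ₂₁ : ∀ w, Q₂₁ w = ∑ b : ↥(pbox (fine Lc M')) × Fin 4, w b •
        ∑ a' : ↥(pbox M') × Fin 4, ((stepScale 3 Lc (j + 1) / (stepScale 3 Lc j ^ 2 * ((box (3 + 1) Lc).card : ℝ))) * Q₁₀ a' b) •
          (perF M' (dper M' (symVhSAt (ctr 4 Lc) 3 Lc rfl a'.2 (a'.1 : Site 4)))).submatrix (fun a : κ => ((pμ' a, Sum.inr (mμ' a)) : Idx M' (Fib 3)))
            (fun b : ↥(pbox M') × Fin 4 => ((b.1, Sum.inl b.2) : Idx M' (Fib 3))))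
    -- ORDER 2 (the OWNER d1-p3 g22's ruling on Q-d1leaf02-g22-1): the second-bond-periodised border bi-families on `F` (fine) and on `M′` (coarse)
    {W₁₂ : Fin 4 → Site 4 → Fin 4 → Site 4 → MKer 4 (Fib 3)}
    (hW₁₂ : W₁₂ = fun κ' u' κ u x z a c => ∑' n : Site 4, symVh₂SAn1 3 Lc κ u κ' (translate (fine Lc M') u' n) x z a c)
    (Q₁₂ : (↥(pbox (fine Lc M')) × Fin 4 → ℝ) → (↥(pbox (fine Lc M')) × Fin 4 → ℝ) → Matrix (↥(pbox M') × Fin 4) (↥(pbox (fine Lc M')) × Fin 4) ℝ)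
    (hQ₁₂ : ∀ w w', Q₁₂ w w' = -(((Lc : ℝ) ^ (3 + 1) * stepScale 3 Lc j)⁻¹) • ∑ b : ↥(pbox (fine Lc M')) × Fin 4, ∑ b' : ↥(pbox (fine Lc M')) × Fin 4, (w b * w' b') •
        (perF (fine Lc M') (dper (fine Lc M') (W₁₂ b'.2 (b'.1 : Site 4) b.2 (b.1 : Site 4)))).submatrix
          (fun a : ↥(pbox M') × Fin 4 => ((coarsePt M' Lc a.1, Sum.inr a.2) : Idx (fine Lc M') (Fib 3)))
          (fun c : ↥(pbox (fine Lc M')) × Fin 4 => ((c.1, Sum.inl c.2) : Idx (fine Lc M') (Fib 3))))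
    {W₂₂ : Fin 4 → Site 4 → Fin 4 → Site 4 → MKer 4 (Fib 3)}
    (hW₂₂ : W₂₂ = fun κ' u' κ u x z a c => ∑' n : Site 4, symVh₂SAn1 3 Lc κ u κ' (translate M' u' n) x z a c)
    (Q₂₂ : (↥(pbox (fine Lc M')) × Fin 4 → ℝ) → (↥(pbox (fine Lc M')) × Fin 4 → ℝ) → Matrix κ (↥(pbox M') × Fin 4) ℝ)
    (hQ₂₂ : ∀ w w', Q₂₂ w w' = -(((Lc : ℝ) ^ (3 + 1) * stepScale 3 Lc (j + 1))⁻¹) • (∑ a' : ↥(pbox M') × Fin 4, ∑ a'' : ↥(pbox M') × Fin 4,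
          (((stepScale 3 Lc (j + 1) / (stepScale 3 Lc j ^ 2 * ((box (3 + 1) Lc).card : ℝ))) * ∑ b : ↥(pbox (fine Lc M')) × Fin 4, Q₁₀ a' b * w b) * ((stepScale 3 Lc (j + 1) / (stepScale 3 Lc j ^ 2 * ((box (3 + 1) Lc).card : ℝ))) * ∑ b : ↥(pbox (fine Lc M')) × Fin 4, Q₁₀ a'' b * w' b)) •
            (perF M' (dper M' (W₂₂ a''.2 (a''.1 : Site 4) a'.2 (a'.1 : Site 4)))).submatrix (fun a : κ => ((pμ' a, Sum.inr (mμ' a)) : Idx M' (Fib 3)))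
            (fun b : ↥(pbox M') × Fin 4 => ((b.1, Sum.inl b.2) : Idx M' (Fib 3))))
        + ∑ a' : ↥(pbox M') × Fin 4, ((stepScale 3 Lc (j + 1) / (stepScale 3 Lc j ^ 2 * ((box (3 + 1) Lc).card : ℝ))) * ∑ b' : ↥(pbox (fine Lc M')) × Fin 4, Q₁₁ w a' b' * w' b') •
          (perF M' (dper M' (symVhSAt (ctr 4 Lc) 3 Lc rfl a'.2 (a'.1 : Site 4)))).submatrix (fun a : κ => ((pμ' a, Sum.inr (mμ' a)) : Idx M' (Fib 3)))
            (fun b : ↥(pbox M') × Fin 4 => ((b.1, Sum.inl b.2) : Idx M' (Fib 3))))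
    -- the chart transports (U18's `hX hXbar` at `d = 3`, level `j`)
    {X : Matrix (↥(pbox (fine Lc M')) × Fin 4) (↥(pbox (fine Lc M')) × Fin 4) ℝ} {Xbar : Matrix κ κ ℝ}
    (hX : X = -((((Lc : ℝ) ^ (3 + 1) * stepScale 3 Lc j)⁻¹) • Matrix.diagonal (fun b : ↥(pbox (fine Lc M')) × Fin 4 => lam b.1)))
    (hXbar : Xbar = (((Lc : ℝ) ^ (3 + 1) * stepScale 3 Lc j)⁻¹) •
        Matrix.diagonal (fun α : κ => ∑ t : ↥(pbox M'), tdelta M' ((pμ' α : Site 4) + ctr 4 Lc) t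
              * (∑ s : ↥(pbox (fine Lc M')), tdelta (fine Lc M') ((Lc : ℤ) • (t : Site 4) + ctr 4 Lc) s * lam s)))
    -- the composite jets NAMED (U18's `h𝔔₀ h𝔔₁ h𝔔₂` with `Q₁₂ := Q₁₂ h h`, `Q₂₂ := Q₂₂ h h`)
    {𝔔₀ 𝔔₁ 𝔔₂ : Matrix κ (↥(pbox (fine Lc M')) × Fin 4) ℝ} (h𝔔₀ : Q₂₀ * Q₁₀ = 𝔔₀) (h𝔔₁ : Q₂₁ h * Q₁₀ + Q₂₀ * Q₁₁ h = 𝔔₁)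
    (h𝔔₂ : Q₂₂ h h * Q₁₀ + Q₂₁ h * Q₁₁ h + (Q₂₁ h * Q₁₁ h + Q₂₀ * Q₁₂ h h) = 𝔔₂) :
    Xbar * Xbar * 𝔔₀ + (Xbar * 𝔔₁ + Xbar * 𝔔₀ * X) + ((Xbar * 𝔔₁ + Xbar * 𝔔₀ * X) + (𝔔₂ + 𝔔₁ * X + (𝔔₁ * X + 𝔔₀ * (X * X))))
      = (-(((Lc : ℝ) ^ (3 + 1) * stepScale 3 Lc (j + 1))⁻¹) • (∑ a' : ↥(pbox M') × Fin 4, ∑ a'' : ↥(pbox M') × Fin 4,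
            (((stepScale 3 Lc (j + 1) / (stepScale 3 Lc j ^ 2 * ((box (3 + 1) Lc).card : ℝ))) * ∑ b : ↥(pbox (fine Lc M')) × Fin 4, Q₁₀ a' b * (h b + ∑ s : ↥(pbox (fine Lc M')), tgrad (fine Lc M') (b.1, Sum.inl b.2) s * lam s))
              * ((stepScale 3 Lc (j + 1) / (stepScale 3 Lc j ^ 2 * ((box (3 + 1) Lc).card : ℝ))) * ∑ b : ↥(pbox (fine Lc M')) × Fin 4, Q₁₀ a'' b * (h b + ∑ s : ↥(pbox (fine Lc M')), tgrad (fine Lc M') (b.1, Sum.inl b.2) s * lam s))) •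
              (perF M' (dper M' (W₂₂ a''.2 (a''.1 : Site 4) a'.2 (a'.1 : Site 4)))).submatrix (fun a : κ => ((pμ' a, Sum.inr (mμ' a)) : Idx M' (Fib 3)))
            (fun b : ↥(pbox M') × Fin 4 => ((b.1, Sum.inl b.2) : Idx M' (Fib 3))))
          + ∑ a' : ↥(pbox M') × Fin 4, ((stepScale 3 Lc (j + 1) / (stepScale 3 Lc j ^ 2 * ((box (3 + 1) Lc).card : ℝ))) * ∑ b' : ↥(pbox (fine Lc M')) × Fin 4, Q₁₁ h a' b' * h b') •
            (perF M' (dper M' (symVhSAt (ctr 4 Lc) 3 Lc rfl a'.2 (a'.1 : Site 4)))).submatrix (fun a : κ => ((pμ' a, Sum.inr (mμ' a)) : Idx M' (Fib 3)))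
            (fun b : ↥(pbox M') × Fin 4 => ((b.1, Sum.inl b.2) : Idx M' (Fib 3)))) * Q₁₀
        + Q₂₁ (fun b => h b + ∑ s : ↥(pbox (fine Lc M')), tgrad (fine Lc M') (b.1, Sum.inl b.2) s * lam s) * Q₁₁ (fun b => h b + ∑ s : ↥(pbox (fine Lc M')), tgrad (fine Lc M') (b.1, Sum.inl b.2) s * lam s)
        + (Q₂₁ (fun b => h b + ∑ s : ↥(pbox (fine Lc M')), tgrad (fine Lc M') (b.1, Sum.inl b.2) s * lam s) * Q₁₁ (fun b => h b + ∑ s : ↥(pbox (fine Lc M')), tgrad (fine Lc M') (b.1, Sum.inl b.2) s * lam s)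
          + Q₂₀ * Q₁₂ (fun b => h b + ∑ s : ↥(pbox (fine Lc M')), tgrad (fine Lc M') (b.1, Sum.inl b.2) s * lam s) (fun b => h b + ∑ s : ↥(pbox (fine Lc M')), tgrad (fine Lc M') (b.1, Sum.inl b.2) s * lam s)) := by
  subst h𝔔₀ h𝔔₁ h𝔔₂
  rw [hQ₂₂ h h]
  exact q2_sim_word Q₂₀ (Q₂₁ h) _ _ _ _ Q₁₀ (Q₁₁ h) (Q₁₂ h h) _ _ _ _ _ (((Lc : ℝ) ^ (3 + 1) * stepScale 3 Lc j)⁻¹) hX hXbar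
    (torus_symQ11_shift M' j h lam hQ₁₀ Q₁₁ hQ₁₁)
    (torus_symQ21_shift M' hM' j h lam pμ' mμ' hQ₁₀ hQ₂₀ Q₂₁ hQ₂₁)
    (torus_symQ12_shift M' j h lam hQ₁₀ Q₁₁ hQ₁₁ hW₁₂ Q₁₂ hQ₁₂)
    (torus_symT22_shift M' hM' j h lam pμ' mμ' hQ₁₀ hQ₂₀ Q₂₁ hQ₂₁ hW₂₂)

end Letter

end Summit.QuantumFields.BalabanUV.Beta.FP.PeriodisedSymCompositeIndexWardTwo

end
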